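import Summits.QuantumFields.YangMills.Theorems.AllWindowsColdBoxBoxHighLineSmearedFPOperator
import Summits.QuantumFields.YangMills.Theorems.AllWindowsColdBoxBoxHighLineQuaternionBCH
import Summits.QuantumFields.YangMills.Theorems.CoarseStiffnessTailCappedCoarseStiffnessLCommutatorChart
import Mathlib
import HarnessLib

/-!
# TASK T-S5/U5 step (1b), brick T-S5.4e (part 1/2, LINK LEVEL): the exact even/odd split of one gauge-transformed link and its
# remainder estimates (planner ym-idea-2 g17, routing 2026-08-29T17:30:23Z (a), shape confirmed 17:31:40Z) — LINE-19 ⟨stmt-QuantumFields-24004⟩/⟨24335⟩, LINE-20 ⟨24336⟩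

Free-hands work of width seat `ym-line-sfw-p2-w3` (g39, cell `ym-idea-1`), over w2 g30's ✓p735122 `…SmearedFPOperator` (`pauliLinkLin`,
`divDefectLin`, `extPauli`, `fpOperator_mulVec`).  Along the gauge orbit `a ↦ U^{exp i a}` (`a : ℤ⁴ → ℝ³` a site field, `(exp ia)_z = expPauli (a z)`)
every transformed link splits EXACTLY into an even and an odd part under `a ↦ −a`:

  `(U^{exp ia})_e = e^{X₋} U_e e^{−X₊} = linkEven + linkOdd`,  `linkEven = c₋c₊·U_e − s₋s₊·X₋U_eX₊`,  `linkOdd = s₋c₊·X₋U_e − c₋s₊·U_eX₊`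

(`X_z = su2Coord (a z)`, `c_z = cos|a_z|`, `s_z = sinc|a_z|`, ✓`exp_su2Coord`, ✓`coe_inv_expPauli`), hence `divDefect (U^{exp ia}) x = divEven + divOdd`
and **`landauPhi H (U^{exp ia}) = phiEven + phiOdd`** with `phiEven = Σ(divEven² + divOdd²)` EVEN and `phiOdd = 2Σ divEven·divOdd` ODD — no Taylor
expansion in the split itself.  QUANTITATIVE part (per site, absolute constants, fields with `|a_z| ≤ 1` near the site): with `m` dominating `|a|` on the
nine sites `x, x ± e_μ`,

* `|divOdd U a x c − divDefectLin U a x c| ≤ 160·m³` (the odd part is the LINEAR term up to a cubic error) and `|divEven U a x c − divDefect U x c| ≤ 112·m²`;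
* at a LANDAU REPRESENTATIVE (`divDefect U x = 0`): `|divEven² + divOdd² − divDefectLin²| ≤ 44608·m⁴` and `|2·divEven·divOdd| ≤ K₃·m²·(|divDefectLin| + m³)`
  per site and colour, which sum to the per-site bounds the Laplace assembly consumes (`phiEven` vs `‖fpOperator H U *ᵥ A‖²` for 4a/4g/4k, `T := β·phiOdd`
  for ✓4h `oddPerturbationBounds`).

Mathlib + tree only; no `sorry`.  HONEST LABEL: one brick of step (1b) of the XL stubs S5/U5; T-S5.4 proper, S5, U5, ⟨24004⟩ ⟨24335⟩ ⟨24336⟩ remain OPEN; no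
crux, rung or summit is proved; the Yang–Mills mass gap is NOT proved by this file.
-/

set_option autoImplicit false

noncomputable section

open Matrix Finset
open scoped Matrix.Norms.Operator
open Literature.MathematicalPhysics.QuantumFieldTheory.Balaban1983to89.B10Eq18SigmaSU2 (su2Coord)
open Literature.MathematicalPhysics.QuantumFieldTheory.Balaban1983to89.B10Eq18SigmaSU2Haar (expPauli coe_expPauli exp_su2Coord expPauli_zero)
open Literature.MathematicalPhysics.QuantumLattice (LGConfig ZdEdge gaugeTransformZd)
open Literature.Probability.LatticeModels (Site)
open Summit.QuantumFields.YangMills.Theorems.CoarseStiffnessTailCommutatorChart (star_su2Coord coe_inv_expPauli)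

namespace Summit.QuantumFields.YangMills.Theorems.AllWindowsColdBoxBoxHighLine

namespace Parity

/-! ## Scalar bounds on `[−1, 1]` -/

/-- `|cos t| ≤ 1`. -/
theorem abs_cos_le (t : ℝ) : |Real.cos t| ≤ 1 := Real.abs_cos_le_one t

/-- `|sinc t| ≤ 1`. -/
theorem abs_sinc_le (t : ℝ) : |Real.sinc t| ≤ 1 := Real.abs_sinc_le_one t

/-- `|cos t − 1| ≤ t²/2`, stated with the square as `t * t`. -/
theorem abs_cos_sub_one_le' (t : ℝ) : |Real.cos t - 1| ≤ t * t / 2 := by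
  have h1 := Real.one_sub_sq_div_two_le_cos (x := t)
  have h2 := Real.cos_le_one t
  rw [abs_sub_comm, abs_of_nonneg (by linarith)]
  nlinarith

/-- `|sinc t − 1| ≤ t²/4` for `|t| ≤ 1` (from Mathlib's `Real.sin_bound`). -/
theorem abs_sinc_sub_one_le' {t : ℝ} (ht : |t| ≤ 1) : |Real.sinc t - 1| ≤ t * t / 4 := by
  by_cases h0 : t = 0
  · subst h0; simp
  · have hb := Real.sin_bound ht
    rw [Real.sinc_of_ne_zero h0]
    have ht0 : 0 < |t| := abs_pos.2 h0
    have key : |Real.sin t - t| ≤ |t| ^ 3 / 4 := by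
      have h1 : |Real.sin t - t| ≤ |Real.sin t - (t - t ^ 3 / 6)| + |t| ^ 3 / 6 := by
        have := abs_sub_le (Real.sin t) (t - t ^ 3 / 6) t
        have h3 : |t - t ^ 3 / 6 - t| = |t| ^ 3 / 6 := by
          rw [show t - t ^ 3 / 6 - t = -(t ^ 3 / 6) by ring, abs_neg, abs_div, abs_pow, abs_of_pos (by norm_num : (0:ℝ) < 6)]
        linarith
      have h4 : |t| ^ 5 ≤ |t| ^ 3 := by
        calc |t| ^ 5 = |t| ^ 3 * (|t| * |t|) := by ring
          _ ≤ |t| ^ 3 * (1 * 1) := mul_le_mul_of_nonneg_left (mul_le_mul ht ht (abs_nonneg _) zero_le_one) (by positivity)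
          _ = |t| ^ 3 := by ring
      nlinarith
    have : |Real.sin t / t - 1| = |Real.sin t - t| / |t| := by
      rw [show Real.sin t / t - 1 = (Real.sin t - t) / t by field_simp, abs_div]
    rw [this, div_le_iff₀ ht0]
    have htt : t * t = |t| ^ 2 := by rw [← sq, sq_abs]
    rw [htt]
    nlinarith

/-! ## Matrix-norm bounds (ℓ∞-operator norm on `M₂(ℂ)`) -/

/-- Each Pauli coordinate is bounded by the Euclidean length. -/
theorem abs_coord_le_norm (v : EuclideanSpace ℝ (Fin 3)) (i : Fin 3) : |v i| ≤ ‖v‖ := by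
  have := PiLp.norm_apply_le v i
  simpa using this

/-- `‖iΣ v_aσ_a‖ ≤ 3|v|` in the ℓ∞-operator norm. -/
theorem norm_su2Coord_le (v : EuclideanSpace ℝ (Fin 3)) : ‖su2Coord v‖ ≤ 3 * ‖v‖ := by
  have h0 := abs_coord_le_norm v 0
  have h1 := abs_coord_le_norm v 1
  have h2 := abs_coord_le_norm v 2
  refine linfty_opNorm_le_of_rows (by positivity) fun i => ?_
  have e1 : ‖((v 0 : ℂ) * Complex.I + v 1)‖ ≤ |v 0| + |v 1| := by
    refine (norm_add_le _ _).trans ?_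
    rw [norm_mul, Complex.norm_I, mul_one, Complex.norm_real, Complex.norm_real, Real.norm_eq_abs, Real.norm_eq_abs]
  have e2 : ‖((v 0 : ℂ) * Complex.I - v 1)‖ ≤ |v 0| + |v 1| := by
    refine (norm_sub_le _ _).trans ?_
    rw [norm_mul, Complex.norm_I, mul_one, Complex.norm_real, Complex.norm_real, Real.norm_eq_abs, Real.norm_eq_abs]
  have e3 : ‖((v 2 : ℂ) * Complex.I)‖ = |v 2| := by
    rw [norm_mul, Complex.norm_I, mul_one, Complex.norm_real, Real.norm_eq_abs]
  have e4 : ‖-((v 2 : ℂ) * Complex.I)‖ = |v 2| := by rw [norm_neg, e3]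
  fin_cases i
  · change ‖((v 2 : ℂ) * Complex.I)‖ + ‖((v 0 : ℂ) * Complex.I + v 1)‖ ≤ 3 * ‖v‖
    rw [e3]; linarith
  · change ‖((v 0 : ℂ) * Complex.I - v 1)‖ + ‖-((v 2 : ℂ) * Complex.I)‖ ≤ 3 * ‖v‖
    rw [e4]; linarith

/-- `‖W‖ ≤ 2` for `W ∈ SU(2)` in the ℓ∞-operator norm (entries of a unitary matrix are bounded by `1`). -/
theorem norm_coe_le_two (W : SU2) : ‖(W : Matrix (Fin 2) (Fin 2) ℂ)‖ ≤ 2 := by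
  have hW : (W : Matrix (Fin 2) (Fin 2) ℂ) ∈ Matrix.unitaryGroup (Fin 2) ℂ := (Matrix.mem_specialUnitaryGroup_iff.1 W.2).1
  refine linfty_opNorm_le_of_rows (by norm_num) fun i => ?_
  have h0 := entry_norm_bound_of_unitary hW i 0
  have h1 := entry_norm_bound_of_unitary hW i 1
  linarith

/-! ## The exact even/odd split of one transformed link -/

/-- EVEN part of `e^{X(p)} U e^{−X(q)}`: `cos|p|cos|q|·U − sinc|p|sinc|q|·X(p)UX(q)`. [problem-side definition] -/
def linkEven (U : Matrix (Fin 2) (Fin 2) ℂ) (p q : EuclideanSpace ℝ (Fin 3)) : Matrix (Fin 2) (Fin 2) ℂ :=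
  ((Real.cos ‖p‖ * Real.cos ‖q‖ : ℝ) : ℂ) • U - ((Real.sinc ‖p‖ * Real.sinc ‖q‖ : ℝ) : ℂ) • (su2Coord p * U * su2Coord q)

/-- ODD part of `e^{X(p)} U e^{−X(q)}`: `sinc|p|cos|q|·X(p)U − cos|p|sinc|q|·UX(q)`. [problem-side definition] -/
def linkOdd (U : Matrix (Fin 2) (Fin 2) ℂ) (p q : EuclideanSpace ℝ (Fin 3)) : Matrix (Fin 2) (Fin 2) ℂ :=
  ((Real.sinc ‖p‖ * Real.cos ‖q‖ : ℝ) : ℂ) • (su2Coord p * U) - ((Real.cos ‖p‖ * Real.sinc ‖q‖ : ℝ) : ℂ) • (U * su2Coord q)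

/-- `X(−x) = −X(x)`. -/
theorem su2Coord_neg (x : Fin 3 → ℝ) : su2Coord (-x) = -su2Coord x := by
  ext i j
  fin_cases i <;> fin_cases j <;> simp [su2Coord] <;> ring

/-- The even part is even. -/
theorem linkEven_neg (U : Matrix (Fin 2) (Fin 2) ℂ) (p q : EuclideanSpace ℝ (Fin 3)) : linkEven U (-p) (-q) = linkEven U p q := by
  simp only [linkEven, norm_neg, WithLp.ofLp_neg, su2Coord_neg, neg_mul, mul_neg, neg_neg]

/-- The odd part is odd. -/
theorem linkOdd_neg (U : Matrix (Fin 2) (Fin 2) ℂ) (p q : EuclideanSpace ℝ (Fin 3)) : linkOdd U (-p) (-q) = -linkOdd U p q := by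
  simp only [linkOdd, norm_neg, WithLp.ofLp_neg, su2Coord_neg, neg_mul, mul_neg, smul_neg]
  abel

/-- **The transformed link splits exactly**: `e^{X(p)} · U · (e^{X(q)})⁻¹ = linkEven + linkOdd`. -/
theorem coe_expPauli_mul_mul_inv (U : Matrix (Fin 2) (Fin 2) ℂ) (p q : EuclideanSpace ℝ (Fin 3)) :
    (expPauli p : Matrix (Fin 2) (Fin 2) ℂ) * U * (((expPauli q)⁻¹ : Matrix.specialUnitaryGroup (Fin 2) ℂ) : Matrix (Fin 2) (Fin 2) ℂ)
      = linkEven U p q + linkOdd U p q := by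
  rw [coe_expPauli, exp_su2Coord, coe_inv_expPauli]
  simp only [linkEven, linkOdd, Complex.ofReal_mul]
  simp only [add_mul, mul_sub, smul_mul_assoc, mul_smul_comm, one_mul, mul_one]
  module

/-! ## Remainder estimates for one link (`|p|, |q| ≤ m ≤ 1`, `‖U‖ ≤ 2`) -/

section LinkBounds

variable {U : Matrix (Fin 2) (Fin 2) ℂ} {p q : EuclideanSpace ℝ (Fin 3)} {m : ℝ}

/-- `‖X(p)·U‖ ≤ 6m` and `‖U·X(q)‖ ≤ 6m`. -/
theorem norm_su2Coord_mul_le (hU : ‖U‖ ≤ 2) (hp : ‖p‖ ≤ m) : ‖su2Coord p * U‖ ≤ 6 * m := by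
  have h1 := norm_su2Coord_le p
  calc ‖su2Coord p * U‖ ≤ ‖su2Coord p‖ * ‖U‖ := norm_mul_le _ _
    _ ≤ (3 * ‖p‖) * 2 := mul_le_mul h1 hU (norm_nonneg _) (by positivity)
    _ ≤ 6 * m := by linarith

/-- `‖U·X(q)‖ ≤ 6m`. -/
theorem norm_mul_su2Coord_le (hU : ‖U‖ ≤ 2) (hq : ‖q‖ ≤ m) : ‖U * su2Coord q‖ ≤ 6 * m := by
  have h1 := norm_su2Coord_le q
  calc ‖U * su2Coord q‖ ≤ ‖U‖ * ‖su2Coord q‖ := norm_mul_le _ _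
    _ ≤ 2 * (3 * ‖q‖) := mul_le_mul hU h1 (norm_nonneg _) (by positivity)
    _ ≤ 6 * m := by linarith

/-- **The odd part is the linear term up to a cubic error**: `‖linkOdd − (X(p)U − UX(q))‖ ≤ 9m³`. -/
theorem norm_linkOdd_sub_lin_le (hU : ‖U‖ ≤ 2) (hp : ‖p‖ ≤ m) (hq : ‖q‖ ≤ m) (hm : m ≤ 1) :
    ‖linkOdd U p q - (su2Coord p * U - U * su2Coord q)‖ ≤ 9 * m ^ 3 := by
  have hm0 : 0 ≤ m := (norm_nonneg p).trans hp
  have hp1 : |‖p‖| ≤ 1 := by rw [abs_of_nonneg (norm_nonneg _)]; linarith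
  have hq1 : |‖q‖| ≤ 1 := by rw [abs_of_nonneg (norm_nonneg _)]; linarith
  -- scalar errors
  have e1 : |Real.sinc ‖p‖ * Real.cos ‖q‖ - 1| ≤ 3 / 4 * m ^ 2 := by
    have h1 : Real.sinc ‖p‖ * Real.cos ‖q‖ - 1 = (Real.sinc ‖p‖ - 1) * Real.cos ‖q‖ + (Real.cos ‖q‖ - 1) := by ring
    rw [h1]
    refine (abs_add_le _ _).trans ?_
    rw [abs_mul]
    have a1 := abs_sinc_sub_one_le' hp1
    have a2 := abs_cos_le ‖q‖
    have a3 := abs_cos_sub_one_le' ‖q‖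
    have hp2 : ‖p‖ * ‖p‖ ≤ m ^ 2 := by rw [sq]; exact mul_le_mul hp hp (norm_nonneg _) hm0
    have hq2 : ‖q‖ * ‖q‖ ≤ m ^ 2 := by rw [sq]; exact mul_le_mul hq hq (norm_nonneg _) hm0
    have : |Real.sinc ‖p‖ - 1| * |Real.cos ‖q‖| ≤ ‖p‖ * ‖p‖ / 4 * 1 :=
      mul_le_mul a1 a2 (abs_nonneg _) (by positivity)
    linarith
  have e2 : |Real.cos ‖p‖ * Real.sinc ‖q‖ - 1| ≤ 3 / 4 * m ^ 2 := by
    have h1 : Real.cos ‖p‖ * Real.sinc ‖q‖ - 1 = Real.cos ‖p‖ * (Real.sinc ‖q‖ - 1) + (Real.cos ‖p‖ - 1) := by ring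
    rw [h1]
    refine (abs_add_le _ _).trans ?_
    rw [abs_mul]
    have a1 := abs_sinc_sub_one_le' hq1
    have a2 := abs_cos_le ‖p‖
    have a3 := abs_cos_sub_one_le' ‖p‖
    have hp2 : ‖p‖ * ‖p‖ ≤ m ^ 2 := by rw [sq]; exact mul_le_mul hp hp (norm_nonneg _) hm0
    have hq2 : ‖q‖ * ‖q‖ ≤ m ^ 2 := by rw [sq]; exact mul_le_mul hq hq (norm_nonneg _) hm0
    have : |Real.cos ‖p‖| * |Real.sinc ‖q‖ - 1| ≤ 1 * (‖q‖ * ‖q‖ / 4) :=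
      mul_le_mul a2 a1 (abs_nonneg _) (by positivity)
    linarith
  -- the difference
  have hdiff : linkOdd U p q - (su2Coord p * U - U * su2Coord q)
      = ((Real.sinc ‖p‖ * Real.cos ‖q‖ - 1 : ℝ) : ℂ) • (su2Coord p * U)
        - ((Real.cos ‖p‖ * Real.sinc ‖q‖ - 1 : ℝ) : ℂ) • (U * su2Coord q) := by
    simp only [linkOdd, Complex.ofReal_sub, Complex.ofReal_one, sub_smul, one_smul]
    abel
  rw [hdiff]
  refine (norm_sub_le _ _).trans ?_
  rw [norm_smul, norm_smul, Complex.norm_real, Complex.norm_real, Real.norm_eq_abs, Real.norm_eq_abs]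
  have b1 := norm_su2Coord_mul_le hU hp
  have b2 := norm_mul_su2Coord_le hU hq
  have t1 : |Real.sinc ‖p‖ * Real.cos ‖q‖ - 1| * ‖su2Coord p * U‖ ≤ (3 / 4 * m ^ 2) * (6 * m) :=
    mul_le_mul e1 b1 (norm_nonneg _) (by positivity)
  have t2 : |Real.cos ‖p‖ * Real.sinc ‖q‖ - 1| * ‖U * su2Coord q‖ ≤ (3 / 4 * m ^ 2) * (6 * m) :=
    mul_le_mul e2 b2 (norm_nonneg _) (by positivity)
  nlinarith

/-- **The even part is the link up to a quadratic error**: `‖linkEven − U‖ ≤ 20m²`. -/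
theorem norm_linkEven_sub_le (hU : ‖U‖ ≤ 2) (hp : ‖p‖ ≤ m) (hq : ‖q‖ ≤ m) :
    ‖linkEven U p q - U‖ ≤ 20 * m ^ 2 := by
  have hm0 : 0 ≤ m := (norm_nonneg p).trans hp
  have e1 : |Real.cos ‖p‖ * Real.cos ‖q‖ - 1| ≤ m ^ 2 := by
    have h1 : Real.cos ‖p‖ * Real.cos ‖q‖ - 1 = (Real.cos ‖p‖ - 1) * Real.cos ‖q‖ + (Real.cos ‖q‖ - 1) := by ring
    rw [h1]
    refine (abs_add_le _ _).trans ?_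
    rw [abs_mul]
    have a1 := abs_cos_sub_one_le' ‖p‖
    have a2 := abs_cos_le ‖q‖
    have a3 := abs_cos_sub_one_le' ‖q‖
    have hp2 : ‖p‖ * ‖p‖ ≤ m ^ 2 := by rw [sq]; exact mul_le_mul hp hp (norm_nonneg _) hm0
    have hq2 : ‖q‖ * ‖q‖ ≤ m ^ 2 := by rw [sq]; exact mul_le_mul hq hq (norm_nonneg _) hm0
    have : |Real.cos ‖p‖ - 1| * |Real.cos ‖q‖| ≤ ‖p‖ * ‖p‖ / 2 * 1 := mul_le_mul a1 a2 (abs_nonneg _) (by positivity)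
    linarith
  have e2 : |Real.sinc ‖p‖ * Real.sinc ‖q‖| ≤ 1 := by
    rw [abs_mul]
    have := mul_le_mul (abs_sinc_le ‖p‖) (abs_sinc_le ‖q‖) (abs_nonneg _) zero_le_one
    linarith
  have b3 : ‖su2Coord p * U * su2Coord q‖ ≤ 18 * m ^ 2 := by
    have h1 := norm_su2Coord_mul_le hU hp
    have h2 := norm_su2Coord_le q
    calc ‖su2Coord p * U * su2Coord q‖ ≤ ‖su2Coord p * U‖ * ‖su2Coord q‖ := norm_mul_le _ _
      _ ≤ (6 * m) * (3 * ‖q‖) := mul_le_mul h1 h2 (norm_nonneg _) (by positivity)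
      _ ≤ (6 * m) * (3 * m) := by nlinarith
      _ = 18 * m ^ 2 := by ring
  have hdiff : linkEven U p q - U = ((Real.cos ‖p‖ * Real.cos ‖q‖ - 1 : ℝ) : ℂ) • U
      - ((Real.sinc ‖p‖ * Real.sinc ‖q‖ : ℝ) : ℂ) • (su2Coord p * U * su2Coord q) := by
    simp only [linkEven, Complex.ofReal_sub, Complex.ofReal_one, sub_smul, one_smul]
    abel
  rw [hdiff]
  refine (norm_sub_le _ _).trans ?_
  rw [norm_smul, norm_smul, Complex.norm_real, Complex.norm_real, Real.norm_eq_abs, Real.norm_eq_abs]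
  have t1 : |Real.cos ‖p‖ * Real.cos ‖q‖ - 1| * ‖U‖ ≤ m ^ 2 * 2 := mul_le_mul e1 hU (norm_nonneg _) (by positivity)
  have t2 : |Real.sinc ‖p‖ * Real.sinc ‖q‖| * ‖su2Coord p * U * su2Coord q‖ ≤ 1 * (18 * m ^ 2) :=
    mul_le_mul e2 b3 (norm_nonneg _) zero_le_one
  linarith

/-- The linear term of one link is `O(m)`: `‖X(p)U − UX(q)‖ ≤ 12m`. -/
theorem norm_lin_le (hU : ‖U‖ ≤ 2) (hp : ‖p‖ ≤ m) (hq : ‖q‖ ≤ m) : ‖su2Coord p * U - U * su2Coord q‖ ≤ 12 * m := by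
  have b1 := norm_su2Coord_mul_le hU hp
  have b2 := norm_mul_su2Coord_le hU hq
  linarith [norm_sub_le (su2Coord p * U) (U * su2Coord q)]

end LinkBounds

end Parity

end Summit.QuantumFields.YangMills.Theorems.AllWindowsColdBoxBoxHighLine

end
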